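import Summits.HubbardSuperconductivity.HubbardSuperconductivity.Theorems.AnisotropyChordInsertionEntropyTeleTransfer

/-!
# Route `AnisotropyChord` / H0 rotor rung: Part S (continued) — `T(ψ) ≤ 0`, «condensate ≥ ρ(1−ρ)·e^{T/2}», the
# test-state (Reatto) form, and `TeleDeconfined` (port of theory seat `hubbard-h0-rotor-theory-1` file
# PartS_Transfer.lean, second half, memo ROTOR-THEORY-9 §136)

* `meanTeleLog_nonpos` (`T(ψ) ≤ 0` by the resampling identity + Jensen), **`condensateDensity_ge_exp_meanTeleLog`**
  (`n₀/|V| ≥ ρ(1−ρ)·exp(T(ψ)/2)` for EVERY non-negative sector state whose support is closed under moves),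
  `meanTeleLog_ge_of_klDiv_le` (sup-KL ⟹ deconfinement);
* two-sector test-state bounds `condensateDensity_ge_test_sq`, `siteOverlap`, `condensateDensity_ge_siteOverlap_sq`,
  `siteOverlap_ge_exp`;
* `TeleDeconfined` / `TeleDeconfinedAlong` — H0's conclusion side in this currency.
-/

set_option linter.dupNamespace false

noncomputable section

open Finset
open Literature.Probability.LatticeModels

namespace Summit.HubbardSuperconductivity.HubbardSuperconductivity.Theorems.AnisotropyChord.InsertionEntropy

section TeleDeconfinement

variable {V : Type} [Fintype V] [DecidableEq V]

/-- **`T(ψ) ≤ 0`** for every non-negative `N`-sector amplitude with `Σ ψ² = 1` and support closed under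
particle moves (resampling identity + Jensen for `log`).  Together with
`condensateDensity_ge_exp_meanTeleLog`, `T(ψ) ∈ [−∞, 0]` is an order parameter for ODLRO. -/
theorem meanTeleLog_nonpos (a : (V → Fin 2) → ℝ) (N : ℝ)
    (hN : ∀ σ, 0 ≤ a σ) (h1 : ∑ σ, a σ ^ 2 = 1)
    (hsect : ∀ σ, a σ ≠ 0 → ((univ.filter fun z => σ z = 0).card : ℝ) = N)
    (hmove : ∀ σ : V → Fin 2, ∀ u v : V, u ≠ v → σ u = 0 → σ v = 1 → 0 < a σ → 0 < a (σ ∘ Equiv.swap u v)) :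
    meanTeleLog a N ≤ 0 := by
  set k : ℝ := N * ((Fintype.card V : ℝ) - N) with hk
  -- the numerator
  set S : ℝ := ∑ σ : V → Fin 2, a σ ^ 2 * ∑ u, ∑ v,
      (if σ u = 0 ∧ σ v = 1 then Real.log (a (σ ∘ Equiv.swap u v) ^ 2 / a σ ^ 2) else 0) with hS
  have hT : meanTeleLog a N = S / k := rfl
  rcases le_or_gt k 0 with hk0 | hkpos
  · -- k ≤ 0: since k ≥ 0 (counts), k = 0 and T = 0
    have hk_nonneg : 0 ≤ k := by
      obtain ⟨σ₀, hσ₀⟩ : ∃ σ, a σ ≠ 0 := by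
        by_contra h
        have : ∑ σ : V → Fin 2, a σ ^ 2 = 0 :=
          Finset.sum_eq_zero fun σ _ => by
            have : a σ = 0 := Classical.not_not.mp fun hσ => h ⟨σ, hσ⟩
            rw [this]; ring
        rw [h1] at this; exact one_ne_zero this
      have hNeq := hsect σ₀ hσ₀
      have hN0 : 0 ≤ N := by rw [← hNeq]; exact Nat.cast_nonneg _
      have hNle : N ≤ (Fintype.card V : ℝ) := by
        rw [← hNeq]; exact_mod_cast Finset.card_le_univ _
      rw [hk]; exact mul_nonneg hN0 (by linarith)
    have hk0' : k = 0 := le_antisymm hk0 hk_nonneg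
    rw [hT, hk0', div_zero]
  · rw [hT, div_le_iff₀ hkpos, zero_mul]
    -- weights and ratios on triples (σ, u, v)
    let W : (V → Fin 2) × V × V → ℝ := fun i => a i.1 ^ 2 * (occ i.1 i.2.1 * (1 - occ i.1 i.2.2))
    let Z : (V → Fin 2) × V × V → ℝ := fun i =>
      if i.1 i.2.1 = 0 ∧ i.1 i.2.2 = 1 ∧ 0 < a i.1 then a (i.1 ∘ Equiv.swap i.2.1 i.2.2) ^ 2 / a i.1 ^ 2 else 1
    have hocc01 : ∀ (σ : V → Fin 2) (u v : V), occ σ u * (1 - occ σ v) = if σ u = 0 ∧ σ v = 1 then 1 else 0 := by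
      intro σ u v; rw [ite_occ_emp_eq σ u v 1, mul_one]
    have hW_nonneg : ∀ i, 0 ≤ W i := fun i => by
      simp only [W]; rw [hocc01]; split_ifs <;> positivity
    have hZ_pos : ∀ i, 0 < Z i := fun i => by
      simp only [Z]
      split_ifs with h
      · have hne : i.2.1 ≠ i.2.2 := by
          intro he; rw [he] at h; rw [h.2.1] at h; exact absurd h.1 (by decide)
        exact div_pos (pow_pos (hmove i.1 i.2.1 i.2.2 hne h.1 h.2.1 h.2.2) 2) (pow_pos h.2.2 2)
      · exact one_pos
    -- S = Σ W log Z
    have hS_eq : S = ∑ i, W i * Real.log (Z i) := by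
      rw [hS, Fintype.sum_prod_type]
      refine Finset.sum_congr rfl fun σ _ => ?_
      rw [Fintype.sum_prod_type, Finset.mul_sum]
      refine Finset.sum_congr rfl fun u _ => ?_
      rw [Finset.mul_sum]
      refine Finset.sum_congr rfl fun v _ => ?_
      simp only [W, Z]
      rw [hocc01]
      by_cases h : σ u = 0 ∧ σ v = 1
      · simp only [if_pos h]
        rcases eq_or_lt_of_le (hN σ) with h0 | hp
        · rw [← h0]; simp
        · rw [if_pos (show σ u = 0 ∧ σ v = 1 ∧ 0 < a σ from ⟨h.1, h.2, hp⟩)]; ring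
      · rw [if_neg h, if_neg (show ¬(σ u = 0 ∧ σ v = 1 ∧ 0 < a σ) from fun h' => h ⟨h'.1, h'.2.1⟩)]
        simp
    -- Σ W = k
    have hW_sum : ∑ i, W i = k := by
      have : ∑ i, W i = ∑ σ : V → Fin 2, a σ ^ 2 * ((∑ u, occ σ u) * ∑ v, (1 - occ σ v)) := by
        rw [Fintype.sum_prod_type]
        refine Finset.sum_congr rfl fun σ _ => ?_
        rw [Fintype.sum_prod_type, Finset.sum_mul_sum, Finset.mul_sum]
        refine Finset.sum_congr rfl fun u _ => ?_
        rw [Finset.mul_sum]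
      rw [this]
      have h2 : ∀ σ : V → Fin 2, a σ ^ 2 * ((∑ u, occ σ u) * ∑ v, (1 - occ σ v)) = a σ ^ 2 * k := by
        intro σ
        rcases eq_or_ne (a σ) 0 with h0 | hne
        · rw [h0]; ring
        · rw [sum_one_sub_occ_eq, sum_occ_eq_card, hsect σ hne]
      rw [Finset.sum_congr rfl fun σ _ => h2 σ, ← Finset.sum_mul, h1, one_mul]
    -- Σ W Z ≤ k
    have hWZ : ∑ i, W i * Z i ≤ k := by
      have hle : ∀ i, W i * Z i ≤ occ i.1 i.2.1 * (1 - occ i.1 i.2.2) * a (i.1 ∘ Equiv.swap i.2.1 i.2.2) ^ 2 := by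
        rintro ⟨σ, u, v⟩
        simp only [W, Z]
        rw [hocc01]
        by_cases h : σ u = 0 ∧ σ v = 1
        · rw [if_pos h]
          rcases eq_or_lt_of_le (hN σ) with h0 | hp
          · rw [if_neg (show ¬(σ u = 0 ∧ σ v = 1 ∧ 0 < a σ) from fun h' => (lt_irrefl (a σ)) (h0 ▸ h'.2.2))]
            rw [← h0]
            nlinarith [sq_nonneg (a (σ ∘ Equiv.swap u v))]
          · rw [if_pos (show σ u = 0 ∧ σ v = 1 ∧ 0 < a σ from ⟨h.1, h.2, hp⟩)]
            apply le_of_eq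
            field_simp
        · rw [if_neg h, if_neg (show ¬(σ u = 0 ∧ σ v = 1 ∧ 0 < a σ) from fun h' => h ⟨h'.1, h'.2.1⟩)]
          simp
      calc ∑ i, W i * Z i
          ≤ ∑ i : (V → Fin 2) × V × V, occ i.1 i.2.1 * (1 - occ i.1 i.2.2) * a (i.1 ∘ Equiv.swap i.2.1 i.2.2) ^ 2 :=
            Finset.sum_le_sum fun i _ => hle i
        _ = ∑ σ : V → Fin 2, ∑ u, ∑ v, occ σ u * (1 - occ σ v) * a (σ ∘ Equiv.swap u v) ^ 2 := by
            rw [Fintype.sum_prod_type]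
            exact Finset.sum_congr rfl fun σ _ => Fintype.sum_prod_type _
        _ = k := by rw [sum_moves_sq_eq a N hsect, h1, mul_one]
    -- Jensen for log
    have hJ := (strictConcaveOn_log_Ioi.concaveOn).le_map_sum (t := Finset.univ)
      (w := fun i => W i / k) (p := Z)
      (fun i _ => div_nonneg (hW_nonneg i) hkpos.le)
      (by rw [← Finset.sum_div, hW_sum, div_self hkpos.ne'])
      (fun i _ => hZ_pos i)
    simp only [smul_eq_mul] at hJ
    have hlhs : ∑ i, W i / k * Real.log (Z i) = S / k := by
      rw [hS_eq, Finset.sum_div]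
      exact Finset.sum_congr rfl fun i _ => by ring
    have hrhs : ∑ i, W i / k * Z i = (∑ i, W i * Z i) / k := by
      rw [Finset.sum_div]
      exact Finset.sum_congr rfl fun i _ => by ring
    rw [hlhs, hrhs] at hJ
    have hlog : Real.log ((∑ i, W i * Z i) / k) ≤ 0 :=
      Real.log_nonpos (div_nonneg (Finset.sum_nonneg fun i _ =>
        mul_nonneg (hW_nonneg i) (hZ_pos i).le) hkpos.le) (by rw [div_le_one hkpos]; exact hWZ)
    have : S / k ≤ 0 := hJ.trans hlog
    rwa [div_le_iff₀ hkpos, zero_mul] at this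

/-- **CONDENSATE ≥ ρ(1−ρ)·exp(T(ψ)/2)** — the model-independent one-liner: for a non-negative `N`-sector
amplitude with `Σ ψ² = 1`, symmetric pair masses, teleportation-support symmetry and support closed under
particle moves, `n₀/|V| ≥ (N/|V|)(1 − N/|V|) · exp(meanTeleLog ψ / 2)`. -/
theorem condensateDensity_ge_exp_meanTeleLog [Nonempty V] (a : (V → Fin 2) → ℝ) (N : ℝ)
    (hN : ∀ σ, 0 ≤ a σ) (h1 : ∑ σ, a σ ^ 2 = 1)
    (hsect : ∀ σ, a σ ≠ 0 → ((univ.filter fun z => σ z = 0).card : ℝ) = N)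
    (hsym : ∀ x y, pairMass a x y = pairMass a y x)
    (hac : ∀ x y τ, x ≠ y → 0 < teleLaw a x y τ → 0 < teleLaw a y x τ)
    (hmove : ∀ σ : V → Fin 2, ∀ u v : V, u ≠ v → σ u = 0 → σ v = 1 → 0 < a σ → 0 < a (σ ∘ Equiv.swap u v)) :
    (N / Fintype.card V) * (1 - N / Fintype.card V) * Real.exp (meanTeleLog a N / 2)
      ≤ condensateDensity a := by
  have hcard : (0:ℝ) < (Fintype.card V : ℝ) := by exact_mod_cast Fintype.card_pos
  by_cases hk : N * ((Fintype.card V : ℝ) - N) = 0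
  · have h0 : (N / Fintype.card V) * (1 - N / Fintype.card V) = 0 := by
      have : (N / Fintype.card V) * (1 - N / Fintype.card V)
          = N * ((Fintype.card V : ℝ) - N) / (Fintype.card V : ℝ) ^ 2 := by field_simp
      rw [this, hk, zero_div]
    rw [h0, zero_mul]
    exact condensateDensity_nonneg a
  · have hId := sum_pairMass_mul_klDiv_eq a hN hsym hmove
    have hK : ∑ x, ∑ y ∈ univ.erase x, pairMass a x y * klDiv (teleLaw a x y) (teleLaw a y x)
        ≤ (-meanTeleLog a N) * (N * ((Fintype.card V : ℝ) - N)) := by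
      rw [hId]
      unfold meanTeleLog
      rw [neg_mul, div_mul_cancel₀ _ hk]
    have h := condensateDensity_ge_of_avgTeleEntropy a N (-meanTeleLog a N) hN h1 hsect hsym hac hK
    have he : -(-meanTeleLog a N) / 2 = meanTeleLog a N / 2 := by ring
    rw [he] at h
    exact h



/-- **sup-KL ⇒ deconfinement:** a uniform per-pair teleportation-entropy bound `KL_{xy} ≤ K` (what the §135
chain proves for the Jastrow–sheet states) gives `meanTeleLog ≥ −K`. -/
theorem meanTeleLog_ge_of_klDiv_le [Nonempty V] (a : (V → Fin 2) → ℝ) (N K : ℝ) (hK0 : 0 ≤ K)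
    (hN : ∀ σ, 0 ≤ a σ) (h1 : ∑ σ, a σ ^ 2 = 1)
    (hsect : ∀ σ, a σ ≠ 0 → ((univ.filter fun z => σ z = 0).card : ℝ) = N)
    (hsym : ∀ x y, pairMass a x y = pairMass a y x)
    (hmove : ∀ σ : V → Fin 2, ∀ u v : V, u ≠ v → σ u = 0 → σ v = 1 → 0 < a σ → 0 < a (σ ∘ Equiv.swap u v))
    (hK : ∀ x y, x ≠ y → klDiv (teleLaw a x y) (teleLaw a y x) ≤ K) :
    -K ≤ meanTeleLog a N := by
  set k : ℝ := N * ((Fintype.card V : ℝ) - N) with hk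
  by_cases hk0 : k = 0
  · unfold meanTeleLog; rw [← hk, hk0, div_zero]; linarith
  · have hmass : ∑ x, ∑ y ∈ univ.erase x, pairMass a x y = k := sum_pairMass_eq a N h1 hsect
    have hk_nonneg : 0 ≤ k := by
      rw [← hmass]
      exact Finset.sum_nonneg fun x _ => Finset.sum_nonneg fun y _ => pairMass_nonneg a x y
    have hkpos : 0 < k := lt_of_le_of_ne hk_nonneg (Ne.symm hk0)
    have hsum : ∑ x, ∑ y ∈ univ.erase x, pairMass a x y * klDiv (teleLaw a x y) (teleLaw a y x) ≤ K * k := by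
      rw [← hmass, Finset.mul_sum]
      refine Finset.sum_le_sum fun x _ => ?_
      rw [Finset.mul_sum]
      refine Finset.sum_le_sum fun y hy => ?_
      rw [mul_comm K]
      exact mul_le_mul_of_nonneg_left (hK x y (Finset.ne_of_mem_erase hy).symm) (pairMass_nonneg a x y)
    rw [sum_pairMass_mul_klDiv_eq a hN hsym hmove] at hsum
    -- hsum : −(numerator) ≤ K k ;  meanTeleLog = numerator / k
    unfold meanTeleLog
    rw [← hk, le_div_iff₀ hkpos]
    linarith

/-! ### Two-sector (test-state) form — Reatto's «(N+1)-th particle as a test charge» in quantum form -/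

/-- **TEST-STATE LOWER BOUND (Bessel).**  For ANY real amplitude `ψ` and any test vector `b` with
`Σ b² ≤ 1` (think: the ground state of the adjacent `(N−1)`-sector):
`condensateDensity ψ ≥ ⟨b, S⁻_tot ψ⟩² / |V|²`.  With translation invariance `⟨b, b_u ψ⟩ = φ̄` for every
`u`, this reads `n₀/|V| ≥ φ̄²` — ODLRO ⟸ a uniform inter-sector one-particle overlap. -/
theorem condensateDensity_ge_test_sq (a b : (V → Fin 2) → ℝ) (hb : ∑ τ, b τ ^ 2 ≤ 1) :
    (∑ τ, b τ * lowerSum a τ) ^ 2 / (Fintype.card V : ℝ) ^ 2 ≤ condensateDensity a := by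
  unfold condensateDensity lowerNormSq
  have hcard : (0:ℝ) ≤ (Fintype.card V : ℝ) ^ 2 := by positivity
  refine div_le_div_of_nonneg_right ?_ hcard
  calc (∑ τ, b τ * lowerSum a τ) ^ 2
      ≤ (∑ τ, b τ ^ 2) * ∑ τ, lowerSum a τ ^ 2 := Finset.sum_mul_sq_le_sq_mul_sq _ _ _
    _ ≤ 1 * ∑ τ, lowerSum a τ ^ 2 :=
        mul_le_mul_of_nonneg_right hb (Finset.sum_nonneg fun τ _ => sq_nonneg _)
    _ = ∑ τ, lowerSum a τ ^ 2 := one_mul _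

/-- Inter-sector one-particle overlap `φ_b(u) = ⟨b, b_u ψ⟩ = Σ_{τ : τ u = 1} b(τ) ψ(τ + u)`. -/
def siteOverlap (a b : (V → Fin 2) → ℝ) (u : V) : ℝ :=
  ∑ τ, if τ u = 1 then b τ * a (Function.update τ u 0) else 0

omit [DecidableEq V] in
/-- `c · (if P then x else 0) = if P then c·x else 0`. [folklore] -/
private theorem mul_ite_zero (c : ℝ) (P : Prop) [Decidable P] (x : ℝ) :
    c * (if P then x else 0) = if P then c * x else 0 := by
  split_ifs <;> simp

/-- `⟨b, S⁻_tot ψ⟩ = Σ_u φ_b(u)`. -/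
theorem sum_mul_lowerSum_eq (a b : (V → Fin 2) → ℝ) :
    ∑ τ, b τ * lowerSum a τ = ∑ u, siteOverlap a b u := by
  unfold lowerSum siteOverlap
  rw [Finset.sum_comm]
  refine Finset.sum_congr rfl fun τ _ => ?_
  rw [Finset.mul_sum]
  exact Finset.sum_congr rfl fun u _ => mul_ite_zero _ _ _

/-- **TEST-STATE BOUND, site form:** `condensateDensity ψ ≥ ((1/|V|) Σ_u φ_b(u))²`. -/
theorem condensateDensity_ge_siteOverlap_sq (a b : (V → Fin 2) → ℝ) (hb : ∑ τ, b τ ^ 2 ≤ 1) :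
    ((∑ u, siteOverlap a b u) / (Fintype.card V : ℝ)) ^ 2 ≤ condensateDensity a := by
  rw [div_pow, ← sum_mul_lowerSum_eq]
  exact condensateDensity_ge_test_sq a b hb

/-- **INSERTION-COST (Jensen) FORM of the site overlap.**  For `b ≥ 0` and `ψ(τ+u) > 0` wherever
`b(τ) > 0, τ u = 1`: `φ_b(u) ≥ m_b(u) · exp(−½ · E_{b²}[I_u | u empty])` with `m_b(u) = Σ_{τ u = 1} b(τ)²`
(the hole probability at `u` under `b²`) and the INSERTION LOG-COST `I_u(τ) = −2 log(ψ(τ+u)/b(τ))`.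
So ODLRO ⟸ bounded mean insertion log-cost of one particle into the adjacent-sector state `b`. -/
theorem siteOverlap_ge_exp (a b : (V → Fin 2) → ℝ) (u : V) (hb : ∀ τ, 0 ≤ b τ)
    (hpos : ∀ τ, τ u = 1 → 0 < b τ → 0 < a (Function.update τ u 0))
    (m I : ℝ) (hm : 0 < m) (hmass : ∑ τ, (if τ u = 1 then b τ ^ 2 else 0) = m)
    (hI : ∑ τ, (if τ u = 1 then b τ ^ 2 *
        (-2 * Real.log (a (Function.update τ u 0) / b τ)) else 0) ≤ I * m) :
    m * Real.exp (-I / 2) ≤ siteOverlap a b u := by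
  -- weights w τ = [τ u = 1] b τ², exponents z τ = log(ψ(τ+u)/b(τ)) (0 off the support)
  let w : (V → Fin 2) → ℝ := fun τ => if τ u = 1 then b τ ^ 2 else 0
  let z : (V → Fin 2) → ℝ := fun τ =>
    if τ u = 1 ∧ 0 < b τ then Real.log (a (Function.update τ u 0) / b τ) else 0
  have hw : ∀ τ, 0 ≤ w τ := fun τ => by simp only [w]; split_ifs <;> positivity
  have hwsum : ∑ τ, w τ = m := hmass
  have hJ := mass_mul_exp_avg_le w z m hm hw hwsum
  -- Σ w z ≥ −I m / 2
  have hwz : ∑ τ, w τ * z τ = -(1/2) * ∑ τ, (if τ u = 1 then b τ ^ 2 *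
        (-2 * Real.log (a (Function.update τ u 0) / b τ)) else 0) := by
    rw [Finset.mul_sum]
    refine Finset.sum_congr rfl fun τ _ => ?_
    simp only [w, z]
    by_cases hu : τ u = 1
    · rw [if_pos hu, if_pos hu]
      rcases eq_or_lt_of_le (hb τ) with h0 | hp
      · rw [← h0]; simp
      · rw [if_pos ⟨hu, hp⟩]; ring
    · rw [if_neg hu, if_neg hu, if_neg (fun h => hu h.1)]; ring
  have havg : -I / 2 ≤ (∑ τ, w τ * z τ) / m := by
    rw [le_div_iff₀ hm, hwz]
    nlinarith [hI]
  -- Σ w e^z = φ_b(u) on the support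
  have hsum : ∑ τ, w τ * Real.exp (z τ) ≤ siteOverlap a b u := by
    unfold siteOverlap
    refine Finset.sum_le_sum fun τ _ => ?_
    simp only [w, z]
    by_cases hu : τ u = 1
    · rw [if_pos hu, if_pos hu]
      rcases eq_or_lt_of_le (hb τ) with h0 | hp
      · rw [← h0]; simp
      · have ha : 0 < a (Function.update τ u 0) := hpos τ hu hp
        rw [if_pos ⟨hu, hp⟩, Real.exp_log (div_pos ha hp)]
        apply le_of_eq
        field_simp
    · rw [if_neg hu, if_neg hu, zero_mul]
  calc m * Real.exp (-I / 2) ≤ m * Real.exp ((∑ τ, w τ * z τ) / m) :=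
        mul_le_mul_of_nonneg_left (Real.exp_le_exp.mpr havg) hm.le
    _ ≤ ∑ τ, w τ * Real.exp (z τ) := hJ
    _ ≤ siteOverlap a b u := hsum

/-- **H0-T (teleportation deconfinement)** for a family of sector amplitudes `ψ_L` on the tori `(ℤ/L)²`
with particle numbers `N_L`: the mean teleportation log-ratio is bounded below uniformly in `L`.
With uniform density and support symmetry this gives ODLRO (`condensateDensity ≥ ρ(1−ρ)e^{−K/2}`) by
`condensateDensity_ge_of_avgTeleEntropy`; the theory seat's conjecture H0 reads: uniform transverse
stiffness + compressibility of the ground states ⇒ `TeleDeconfined`.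
[conjecture: theory seat hubbard-h0-rotor-theory-1, cycle 9, 2026-08-28 — memo ROTOR-THEORY-9 §136 (H0-T, the programme's target property; typed)] -/
def TeleDeconfined (a : ∀ L : ℕ, (TorusSite 2 L → Fin 2) → ℝ) (N : ℕ → ℝ) : Prop :=
  ∃ K : ℝ, ∀ L : ℕ, ∀ [NeZero L], 2 ≤ L → -K ≤ meanTeleLog (a L) (N L)


/-- Variant along a sub-family of sizes (e.g. `P L := Even L` for half filling `N_L = L²/2`): the §135 chain
(`klDiv_halfXSheet_le_of_energyFloor` + `xsheetEnergyFloor_of_PSD` + `xsheetKernelPSD_self` in Sketch9) together with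
`meanTeleLog_ge_of_klDiv_le` gives `TeleDeconfinedAlong Even` for the jellium-sheet Jastrow states at every `β ≥ 0`.
[conjecture: theory seat hubbard-h0-rotor-theory-1, cycle 9, 2026-08-28 — memo ROTOR-THEORY-9 §136 (typed variant of H0-T)] -/
def TeleDeconfinedAlong (P : ℕ → Prop) (a : ∀ L : ℕ, (TorusSite 2 L → Fin 2) → ℝ) (N : ℕ → ℝ) : Prop :=
  ∃ K : ℝ, ∀ L : ℕ, ∀ [NeZero L], 2 ≤ L → P L → -K ≤ meanTeleLog (a L) (N L)

/-- `TeleDeconfined ⟹ TeleDeconfinedAlong P` for every `P`. [folklore] -/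
theorem teleDeconfinedAlong_of_teleDeconfined (P : ℕ → Prop) (a : ∀ L : ℕ, (TorusSite 2 L → Fin 2) → ℝ)
    (N : ℕ → ℝ) (h : TeleDeconfined a N) : TeleDeconfinedAlong P a N := by
  obtain ⟨K, hK⟩ := h
  exact ⟨K, fun L _ hL _ => hK L hL⟩

end TeleDeconfinement

end Summit.HubbardSuperconductivity.HubbardSuperconductivity.Theorems.AnisotropyChord.InsertionEntropy
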